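import Literature.Topology.FourManifolds.HandleConjugation
import Literature.Topology.FourManifolds.HandleStageField
import HarnessLib

/-!
# Construction of the data of the handle-extension step on one manifold

Topic `Literature/Topology/FourManifolds` (fact seat
`provefact-Literature.Topology.FourManifolds.IsHandlebody.exists_isBoundaryGluing_sphere`, step F2b of
the Lickorish–Wallace DAG; data layer of the handle-extension step of the classification of
handlebodies).  Everything here is **proved**; no named facts.

`HandleConjugation.lean` works with the abstract data `Literature.Topology.FourManifolds.HandleSide`
of one manifold: a function `f`, a vector field `X` with a handle chart `D` at the critical point
`p`, its smooth global flow `θ`, and parameters `ε, γ, η, a, ℓ₁, ℓ₂, ℓ⁺, δ` subject to a list of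
inequalities and structural hypotheses (unit speed off the core, speed in `[0, 1]`, closed
regions, the core inside the regions).  This file **produces that data** on a compact manifold
with boundary from a Morse chart in Milnor's normal form at `p` (`exists_handleSide_data`):
the field is the one of `HandleStageField.lean` (Milnor's model at `p`, unit speed on a slab,
a prescribed germ on a band, zero near the boundary; Milnor 1965, Def. 3.1, Lemma 3.2, proof of
Thm. 3.4), the flow is its global flow (`IsInteriorField.isSmoothFlow`, Lee 2012, Thm. 9.16),
the speed in the core is at most `1` because `8r² ≤ 1` (`speedFactor_mul_le_one`), the regions
are closed by `HandleChart.isCompact_region` and contain the core by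
`HandleChart.core_subset_region`.

## References

* J. Milnor, *Lectures on the h-cobordism theorem* (1965), Def. 3.1, Lemma 3.2, proofs of
  Thm. 3.4 and Thm. 3.13. [MilnorHCobordism1965]
* J. M. Lee, *Introduction to Smooth Manifolds*, 2nd ed. (2012), Thm. 9.16. [LeeSmoothManifolds2013]
-/

open scoped Manifold ContDiff Topology
open Set Function Filter Metric

noncomputable section

namespace Literature.Topology.FourManifolds

universe u

/-- **Speed in the core is at most `1`** when `8r² ≤ 1`: for `‖u‖ ≤ 2r`,
`g_r(u) · 2‖u‖² = 2‖u‖² χ_r(u) + (1 - χ_r(u)) ≤ 1`. [folklore] -/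
theorem speedFactor_mul_le_one {m : ℕ} {r : ℝ} (hr : 0 < r) (h8 : 8 * r ^ 2 ≤ 1)
    {u : EuclideanSpace ℝ (Fin m)} (hu : ‖u‖ ≤ 2 * r) :
    speedFactor hr u * (2 * ‖u‖ ^ 2) ≤ 1 := by
  have h0 : 0 ≤ (handleCoreBump (m := m) hr : EuclideanSpace ℝ (Fin m) → ℝ) u := (handleCoreBump hr).nonneg
  have h1 : (handleCoreBump (m := m) hr : EuclideanSpace ℝ (Fin m) → ℝ) u ≤ 1 := (handleCoreBump hr).le_one
  have hsq : 2 * ‖u‖ ^ 2 ≤ 1 := by nlinarith [norm_nonneg u]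
  by_cases hu0 : u = 0
  · subst hu0; simp
  · have hpos : 0 < 2 * ‖u‖ ^ 2 := by have := norm_pos_iff.2 hu0; positivity
    unfold speedFactor
    rw [add_mul, mul_assoc, inv_mul_cancel₀ hpos.ne', mul_one]
    nlinarith

variable {n : ℕ} {M : Type u} [TopologicalSpace M] [T2Space M] [CompactSpace M]
  [ChartedSpace (EuclideanHalfSpace (n + 1)) M] [IsManifold (𝓡∂ (n + 1)) ∞ M]

/-- Local notation: `𝔼 m` is the model Euclidean space `EuclideanSpace ℝ (Fin m)`. -/
local notation "𝔼 " m:arg => EuclideanSpace ℝ (Fin m)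

/-- **The data of the handle-extension step on one manifold.**  On a compact manifold with
boundary: `f` smooth with `f > ℓ₃` on the boundary, a point `p` with a chart `φ` of the
maximal atlas in Milnor's form `f = f p + Q_k(φ̂ - φ̂ p)` on `φ.source`, the closed chart ball of
radius `5ε` in the chart target, a core radius `r` with `8r² ≤ 1`, `2r < ε`, `32 r⁴ ≤ γ`, levels
`ℓ₀ < ℓ₁ ≤ f p - 16ε²`, `f p + 16ε² ≤ ℓ₂ < ℓ₃` with `p` the only critical point in
`f⁻¹[ℓ₀, ℓ₃]`, region levels with `f p - ε² + γ/ε² < a - η/4 ≤ f p - 4r²`, `f p + 4r² ≤ ℓ⁺ - δ`,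
`ℓ⁺ < f p + 4ε² - γ/(4ε²)`, `0 < δ`, `0 < η`, and a unit-speed germ `ξ₂` on an open `U₂ ⊇ K₂`
(closed, inside `f⁻¹[ℓ₁, ℓ₂]`, `U₂` disjoint from the chart ball of radius `5ε`).  Conclusion:
a field `X`, its smooth global flow `θ`, and a handle chart `D` at `p` with the coordinates of
`φ`, index `k`, core radius `r`, such that: `X` is a smooth interior field, `X = ξ₂` on `K₂`,
`X(f) = 1` on `f⁻¹[ℓ₁, ℓ₂]` off the core of `D`, `X(f) ∈ [0, 1]` on `f⁻¹[ℓ₁, ℓ₂]`, the three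
regions of `HandleConjugation.lean` are closed and the core lies in the half-constant region
strictly above the level `a - η/4`. [cite: MilnorHCobordism1965, Def. 3.1, Lemma 3.2 and proofs of Thms. 3.4, 3.13] -/
theorem exists_handleSide_data {f : M → ℝ} (hf : ContMDiff (𝓡∂ (n + 1)) 𝓘(ℝ, ℝ) ∞ f)
    {ℓ₀ ℓ₁ ℓ₂ ℓ₃ : ℝ} (h01 : ℓ₀ < ℓ₁) (h23 : ℓ₂ < ℓ₃)
    (hbd : ∀ x ∈ (𝓡∂ (n + 1)).boundary M, ℓ₃ < f x)
    {p : M} {φ : OpenPartialHomeomorph M (EuclideanHalfSpace (n + 1))}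
    (hφ : φ ∈ IsManifold.maximalAtlas (𝓡∂ (n + 1)) ∞ M) (hpφ : p ∈ φ.source) {k : ℕ}
    (hfq : ∀ q ∈ φ.source, f q = f p +
      milnorQuadratic k (φ.extend (𝓡∂ (n + 1)) q - φ.extend (𝓡∂ (n + 1)) p))
    {ε r γ η a ℓu δ : ℝ} (hε : 0 < ε) (hr : 0 < r) (h8 : 8 * r ^ 2 ≤ 1) (hrε : 2 * r < ε)
    (hγ : 32 * r ^ 4 ≤ γ) (hη : 0 < η) (hδ : 0 < δ)
    (hR : closedBall (φ.extend (𝓡∂ (n + 1)) p) (5 * ε) ⊆ (φ.extend (𝓡∂ (n + 1))).target)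
    (hℓ₁ : ℓ₁ ≤ f p - 16 * ε ^ 2) (hℓ₂ : f p + 16 * ε ^ 2 ≤ ℓ₂)
    (hreg : ∀ x, f x ∈ Icc ℓ₀ ℓ₃ → x ≠ p → mfderiv (𝓡∂ (n + 1)) 𝓘(ℝ, ℝ) f x ≠ 0)
    (hlow : f p - ε ^ 2 + γ / ε ^ 2 < a - η / 4) (hal : a - η / 4 ≤ f p - 4 * r ^ 2)
    (hau : f p + 4 * r ^ 2 ≤ ℓu - δ) (hhigh : ℓu < f p + 4 * ε ^ 2 - γ / (4 * ε ^ 2))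
    {K₂ U₂ : Set M} (hK₂ : IsClosed K₂) (hU₂ : IsOpen U₂) (hKU₂ : K₂ ⊆ U₂)
    (hK₂ℓ : ∀ x ∈ K₂, f x ∈ Icc ℓ₁ ℓ₂)
    (hdisj : Disjoint U₂ (φ.source ∩ φ.extend (𝓡∂ (n + 1)) ⁻¹' ball (φ.extend (𝓡∂ (n + 1)) p) (5 * ε)))
    {ξ₂ : Π x : M, TangentSpace (𝓡∂ (n + 1)) x}
    (hξ₂ : ContMDiffOn (𝓡∂ (n + 1)) (𝓡∂ (n + 1)).tangent ∞
      (fun x => (⟨x, ξ₂ x⟩ : TangentBundle (𝓡∂ (n + 1)) M)) U₂)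
    (hξ₂f : ∀ x ∈ U₂, mlineDeriv (𝓡∂ (n + 1)) f x (ξ₂ x) = 1) :
    ∃ (X : Π x : M, TangentSpace (𝓡∂ (n + 1)) x) (θ : ℝ × M → M) (D : HandleChart (𝓡∂ (n + 1)) f X p),
      IsInteriorField (𝓡∂ (n + 1)) X ∧ IsSmoothFlow (𝓡∂ (n + 1)) X θ ∧
      D.k = k ∧ D.r = r ∧ (∀ q, D.chart.extend (𝓡∂ (n + 1)) q = φ.extend (𝓡∂ (n + 1)) q) ∧
      D.chart.source = φ.source ∩ φ.extend (𝓡∂ (n + 1)) ⁻¹' ball (φ.extend (𝓡∂ (n + 1)) p) (4 * ε) ∧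
      closedBall (D.chart.extend (𝓡∂ (n + 1)) p) (3 * ε) ⊆ (D.chart.extend (𝓡∂ (n + 1))).target ∧
      (∀ x ∈ K₂, X x = ξ₂ x) ∧
      (∀ x, f x ∈ Icc ℓ₁ ℓ₂ → x ∉ D.core → mlineDeriv (𝓡∂ (n + 1)) f x (X x) = 1) ∧
      (∀ x, f x ∈ Icc ℓ₁ ℓ₂ → mlineDeriv (𝓡∂ (n + 1)) f x (X x) ∈ Icc (0 : ℝ) 1) ∧
      IsClosed (D.region ε γ (a - η / 4) ℓu) ∧ IsClosed (D.region ε (γ / 2) (a - η / 4) ℓu) ∧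
      IsClosed (D.region ε (γ / 2) a (ℓu - δ)) ∧
      D.core ⊆ D.region ε (γ / 2) (a - η / 4) ℓu ∧ (∀ q ∈ D.core, a - η / 4 < f q) := by
  set Φ := φ.extend (𝓡∂ (n + 1)) with hΦ
  set u₀ := Φ p with hu₀
  -- the field
  have hrR₁ : 2 * r < 4 * ε := by linarith
  have hR₁R : 4 * ε < 5 * ε := by linarith
  have hℓ₁' : ℓ₁ ≤ f p - (4 * ε) ^ 2 := by nlinarith
  have hℓ₂' : f p + (4 * ε) ^ 2 ≤ ℓ₂ := by nlinarith
  obtain ⟨X, D, hXint, hDk, hDr, hDe, hDs, hXK, hunit, hX0, hXO⟩ :=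
    exists_handleField hf h01 h23 hbd hφ hpφ hfq hr hrR₁ hR₁R hR hℓ₁' hℓ₂' hreg hK₂ hU₂ hKU₂ hK₂ℓ hdisj hξ₂ hξ₂f
  -- its flow
  set θ : ℝ × M → M := fun q => hXint.flow q.2 q.1 with hθ
  have hflow : IsSmoothFlow (𝓡∂ (n + 1)) X θ := hXint.isSmoothFlow
  -- the core of `D` is the core ball of radius `2r`
  have hcoord : ∀ q, D.coord q = Φ q - u₀ := fun q => by rw [HandleChart.coord, hDe, hDe]
  have hcore : ∀ x, x ∈ D.core ↔ x ∈ φ.source ∩ Φ ⁻¹' ball u₀ (2 * r) := by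
    intro x
    simp only [HandleChart.core, hDs, hcoord, hDr, mem_setOf_eq, mem_inter_iff, mem_preimage, mem_ball,
      dist_eq_norm]
    constructor
    · rintro ⟨⟨hs, _⟩, hn⟩; exact ⟨hs, hn⟩
    · rintro ⟨hs, hn⟩; exact ⟨⟨hs, by linarith⟩, hn⟩
  -- the chart ball of radius `3ε` in the target of `D.chart`
  have hball : closedBall (D.chart.extend (𝓡∂ (n + 1)) p) (3 * ε) ⊆ (D.chart.extend (𝓡∂ (n + 1))).target := by
    intro v hv
    rw [hDe] at hv
    have hvt : v ∈ Φ.target := hR (closedBall_subset_closedBall (by linarith) hv)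
    have hvs : Φ.symm v ∈ D.chart.source := by
      rw [hDs]
      refine ⟨by rw [← φ.extend_source (I := 𝓡∂ (n + 1))]; exact Φ.map_target hvt, ?_⟩
      show Φ (Φ.symm v) ∈ ball u₀ (4 * ε)
      rw [Φ.right_inv hvt]
      exact closedBall_subset_ball (by linarith) hv
    have h1 : D.chart.extend (𝓡∂ (n + 1)) (Φ.symm v) ∈ (D.chart.extend (𝓡∂ (n + 1))).target :=
      (D.chart.extend (𝓡∂ (n + 1))).map_source (by rw [D.chart.extend_source]; exact hvs)
    rwa [hDe, Φ.right_inv hvt] at h1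
  -- unit speed off the core
  have hunit' : ∀ x, f x ∈ Icc ℓ₁ ℓ₂ → x ∉ D.core → mlineDeriv (𝓡∂ (n + 1)) f x (X x) = 1 :=
    fun x hx hxc => hunit x hx fun h => hxc ((hcore x).2 h)
  -- speed in `[0, 1]` on the slab
  have hspeed : ∀ x, f x ∈ Icc ℓ₁ ℓ₂ → mlineDeriv (𝓡∂ (n + 1)) f x (X x) ∈ Icc (0 : ℝ) 1 := by
    intro x hx
    by_cases hxc : x ∈ D.core
    · have hxs := hxc.1
      refine ⟨D.mlineDeriv_nonneg hxs, ?_⟩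
      rw [D.mlineDeriv_eq hxs]
      exact speedFactor_mul_le_one D.r_pos (by rw [hDr]; exact h8) (u := D.coord x) (by linarith [hxc.2])
    · rw [hunit' x hx hxc]
      exact ⟨zero_le_one, le_rfl⟩
  -- closed regions
  have hγ0 : 0 ≤ γ := le_trans (by positivity) hγ
  have hε2 : 0 < ε ^ 2 := by positivity
  have hlow₁ : f p - ε ^ 2 + γ / 2 / ε ^ 2 < a - η / 4 := by
    have : γ / 2 / ε ^ 2 ≤ γ / ε ^ 2 := by
      rw [div_le_div_iff_of_pos_right hε2]; linarith
    linarith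
  have hhigh₁ : ℓu < f p + 4 * ε ^ 2 - γ / 2 / (4 * ε ^ 2) := by
    have h4 : 0 < 4 * ε ^ 2 := by positivity
    have : γ / 2 / (4 * ε ^ 2) ≤ γ / (4 * ε ^ 2) := by
      rw [div_le_div_iff_of_pos_right h4]; linarith
    linarith
  have hc₁ : IsClosed (D.region ε γ (a - η / 4) ℓu) :=
    (D.isCompact_region hf.continuous hε hball hlow hhigh).isClosed
  have hc₂ : IsClosed (D.region ε (γ / 2) (a - η / 4) ℓu) :=
    (D.isCompact_region hf.continuous hε hball hlow₁ hhigh₁).isClosed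
  have hc₃ : IsClosed (D.region ε (γ / 2) a (ℓu - δ)) :=
    (D.isCompact_region hf.continuous hε hball (by linarith) (by linarith)).isClosed
  -- the core inside the half-constant region, above `a - η/4`
  have hcsub : D.core ⊆ D.region ε (γ / 2) (a - η / 4) ℓu := by
    refine D.core_subset_region (by rw [hDr]; exact hrε) (by rw [hDr]; linarith) (by rw [hDr]; exact hal)
      (by rw [hDr]; linarith)
  have hclev : ∀ q ∈ D.core, a - η / 4 < f q := by
    intro q hq
    have h := D.abs_sub_lt_of_mem_core hq
    rw [abs_lt, hDr] at h
    linarith [h.1]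
  exact ⟨X, θ, D, hXint, hflow, hDk, hDr, hDe, hDs, hball, hXK, hunit', hspeed, hc₁, hc₂, hc₃, hcsub, hclev⟩

end Literature.Topology.FourManifolds
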